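import Summits.ResolutionOfSingularities.ResolutionOfSingularities.Theorems.FrobeniusLadderFInjectiveMacaulayficationFilteredReesHclBDirect
import HarnessLib

/-!
# G4♮-direct — THE FILTERED CHART CLAUSE WITH THE CONE HYPOTHESIS REPLACED BY «CONE OR DIRECT» (engine v2, brick D2)
# (crux `FInjectiveMacaulayfication` stmt-ResolutionOfSingularities-15315; RULING R15.48 (3) of res-L1-w45a-plan-1)

Support file (helper), chain w45a, seat res-L1-w45a-stub-4 g6. [OURS · L1 W4.5a; re-run of res-L1-w45a-lead-1's `FilteredChartClauseV`
chain with one hypothesis changed] — NOT a statement of the manuscript; AI-written, weaker than expert review.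

`FilteredChartClauseV.filteredChartClause_core_v` / `filteredChartClause_v` (G4♮ᵛ) derive the crux clause at the exceptional points
of the `v`-th chart of a weighted blow-up from the clause of the weighted TANGENT CONE `k[X]/(f₀)` at EVERY closed point off `V(x̄_v)`
(consumed once, inside `filteredRees_hclB'_v`).  Rows like F192/5 have a cone with finitely many BAD orbits although the blow-up is
FULL there (the tail of `f` above the facet supplies the Fedder witness).  This file re-runs the two theorems VERBATIM with
`filteredRees_hclB'_v` replaced by brick D1 `FilteredReesHclBDirect.filteredRees_hclB_direct`: the hypothesis `hcone` asks, at each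
maximal `P′` of the deformation ring `k[X,s]/(fh)` with `X_v ∉ P′ ∋ s`, for EITHER the clause of `k[X,s]/(fh)` at `P′` DIRECTLY, OR the
cone clause at the maximal ideals `Q₀` of `k[X]/(f₀)` with `x̄_j ∈ Q₀ ↔ X_j ∈ P′` (so the user decides the branch by which coordinates
lie in `P′`).  `fh` becomes an explicit input (`hfh` its defining sum).  No definitions, no named facts. [folklore]
-/

-- single-problem summit: the doubled namespace component is forced
set_option linter.dupNamespace false

noncomputable section

open scoped LaurentPolynomial
open AddMonoidAlgebra LaurentPolynomial AlgebraicGeometry Literature.AlgebraicGeometry.Resolution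

namespace Summit.ResolutionOfSingularities.ResolutionOfSingularities.Theorems.FInjectiveMacaulayfication.FilteredChartClauseDirect

open Summit.ResolutionOfSingularities.ResolutionOfSingularities.Theorems.FInjectiveMacaulayfication
open FilteredChartClauseV

/-- **(F4d) cone-or-direct form** (`FilteredChartClauseV.filteredChartClause_core_v` with `hcone` in place of `hoffv`). [folklore] -/
theorem filteredChartClause_core_direct (p : ℕ) [Fact p.Prime] (k : Type) [Field k] [CharP k p] (n : ℕ) (w : Fin n → ℕ) (D : ℕ)
    (f : MvPolynomial (Fin n) k) (fh : MvPolynomial (Option (Fin n)) k)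
    (hfh : fh = ∑ b ∈ f.support, MvPolynomial.monomial
      (Finsupp.mapDomain some b + Finsupp.single none (Finsupp.weight w b - D)) (MvPolynomial.coeff b f))
    (hD0 : ∀ m < D, MvPolynomial.weightedHomogeneousComponent w m f = 0)
    (f₀ : MvPolynomial (Fin n) k) (hf₀ : f₀ = MvPolynomial.weightedHomogeneousComponent w D f) (hD : f₀ ≠ 0)
    (hfprime : (Ideal.span {f}).IsPrime) (hXne : ∀ j : Fin n, Ideal.Quotient.mk (Ideal.span {f}) (MvPolynomial.X j) ≠ 0)
    (v : Fin n) (c : ℕ) (hc : 0 < c)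
    (hcone : ∀ (P' : Ideal (MvPolynomial (Option (Fin n)) k ⧸ Ideal.span {fh})) [P'.IsMaximal],
      Ideal.Quotient.mk (Ideal.span {fh}) (MvPolynomial.X (some v)) ∉ P' →
      Ideal.Quotient.mk (Ideal.span {fh}) (MvPolynomial.X none) ∈ P' →
      (∀ d : ℕ, ringKrullDim (Localization.AtPrime P') = d → ∀ t : Fin d → Localization.AtPrime P',
        (Ideal.span (Set.range t)).radical.IsMaximal →
          RingTheory.Sequence.IsWeaklyRegular (Localization.AtPrime P') (List.ofFn t) ∧
          ∀ y : Localization.AtPrime P', (∃ e : ℕ, y ^ p ^ e ∈ Ideal.span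
            ((fun z : Localization.AtPrime P' => z ^ p ^ e) ''
              (Ideal.span (Set.range t) : Set (Localization.AtPrime P')))) → y ∈ Ideal.span (Set.range t)) ∨
      (∀ (Q₀ : Ideal (MvPolynomial (Fin n) k ⧸ Ideal.span {f₀})) [Q₀.IsMaximal],
        (∀ j : Fin n, Ideal.Quotient.mk (Ideal.span {f₀}) (MvPolynomial.X j) ∈ Q₀ ↔
          Ideal.Quotient.mk (Ideal.span {fh}) (MvPolynomial.X (some j)) ∈ P') →
        ∀ d : ℕ, ringKrullDim (Localization.AtPrime Q₀) = d → ∀ t : Fin d → Localization.AtPrime Q₀,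
          (Ideal.span (Set.range t)).radical.IsMaximal →
            RingTheory.Sequence.IsWeaklyRegular (Localization.AtPrime Q₀) (List.ofFn t) ∧
            ∀ y : Localization.AtPrime Q₀, (∃ e : ℕ, y ^ p ^ e ∈ Ideal.span
              ((fun z : Localization.AtPrime Q₀ => z ^ p ^ e) ''
                (Ideal.span (Set.range t) : Set (Localization.AtPrime Q₀)))) → y ∈ Ideal.span (Set.range t)))
    (A' : Subalgebra k (Localization.Away (Ideal.Quotient.mk (Ideal.span {fh}) (MvPolynomial.X (some v)) ^ c))) [Algebra.IsIntegral A' (Localization.Away (Ideal.Quotient.mk (Ideal.span {fh}) (MvPolynomial.X (some v)) ^ c))] (ρ : (Localization.Away (Ideal.Quotient.mk (Ideal.span {fh}) (MvPolynomial.X (some v)) ^ c)) →ₗ[A'] A') (hρ : ∀ x : A', ρ (x : Localization.Away (Ideal.Quotient.mk (Ideal.span {fh}) (MvPolynomial.X (some v)) ^ c)) = x)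
    (N : ℕ) (hsN : (algebraMap (MvPolynomial (Option (Fin n)) k ⧸ Ideal.span {fh}) (Localization.Away (Ideal.Quotient.mk (Ideal.span {fh}) (MvPolynomial.X (some v)) ^ c)) (Ideal.Quotient.mk (Ideal.span {fh}) (MvPolynomial.X none))) ^ N ∈ A')
    (C₀ : Type) [CommRing C₀] [IsNoetherianRing C₀] [CharP C₀ p] (T : Type) [CommRing T] (ι' : C₀ ≃+* T)
    (e : Localization.Away (Polynomial.X : Polynomial T) ≃+* A') (u₀ : C₀)
    (heN : e.symm ⟨_, hsN⟩ ∈ Ideal.span {algebraMap (Polynomial T) (Localization.Away (Polynomial.X : Polynomial T))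
      (Polynomial.C (ι' u₀))})
    (Q : Ideal C₀) [Q.IsMaximal] (huQ : u₀ ∈ Q) :
    ∀ d : ℕ, ringKrullDim (Localization.AtPrime Q) = d → ∀ t : Fin d → Localization.AtPrime Q,
        (Ideal.span (Set.range t)).radical.IsMaximal →
          RingTheory.Sequence.IsWeaklyRegular (Localization.AtPrime Q) (List.ofFn t) ∧
          ∀ y : Localization.AtPrime Q, (∃ e : ℕ, y ^ p ^ e ∈ Ideal.span
            ((fun z : Localization.AtPrime Q => z ^ p ^ e) ''
              (Ideal.span (Set.range t) : Set (Localization.AtPrime Q)))) → y ∈ Ideal.span (Set.range t) := by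
  have hD' : MvPolynomial.weightedHomogeneousComponent w D f ≠ 0 := hf₀ ▸ hD
  haveI := FilteredReesDomain.isDomain_reesAway w D f fh hfh hD0 hD' hfprime hXne v c
  haveI := FilteredReesDomain.charP_reesAway p w D f fh hfh hD0 hD' hfprime hXne v c
  haveI : IsNoetherianRing T := isNoetherianRing_of_ringEquiv C₀ ι'
  haveI : CharP T p := charP_of_injective_ringHom (f := ι'.toRingHom) ι'.injective p
  exact GradedChartClauseAssembly.chartClause_core_affine p k (Localization.Away (Ideal.Quotient.mk (Ideal.span {fh}) (MvPolynomial.X (some v)) ^ c)) A' ρ hρ _ N hsN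
    (fun P _ hsP => (FilteredReesHclBDirect.filteredRees_hclB_direct p k n w D f fh hfh hD0 f₀ hf₀ hD hfprime hXne v c hc hcone
      P hsP).2) C₀ T ι' e u₀ heN Q huQ

set_option maxHeartbeats 800000 in
/-- **G4♮-direct THE FILTERED CHART CLAUSE, cone-or-direct form**: `FilteredChartClauseV.filteredChartClause_v` with the
deformation `fh` an explicit input and its tangent-cone hypothesis replaced by `hcone`: at each maximal `P′` of `k[X,s]/(fh)` with
`X_v ∉ P′ ∋ s`, EITHER the clause of `k[X,s]/(fh)` at `P′` directly OR the cone clause at the maximal `Q₀` of `k[X]/(f₀)` with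
`x̄_j ∈ Q₀ ↔ X_j ∈ P′`.  Same proof text (800k heartbeats inherited). [folklore] -/
theorem filteredChartClause_direct : ∀ (p : ℕ) [Fact p.Prime] (k : Type) [Field k] [CharP k p] (n : ℕ) (w : Fin n → ℕ) (v : Fin n),
    0 < w v → ∀ (N c D : ℕ), c * w v = N → 0 < c →
    (∀ (K : ℕ) (b : Fin n →₀ ℕ), K * N ≤ Finsupp.weight w b → (MvPolynomial.monomial b (1 : k) : MvPolynomial (Fin n) k) ∈
      (Ideal.span {m : MvPolynomial (Fin n) k | ∃ b : Fin n →₀ ℕ, N ≤ Finsupp.weight w b ∧ m = MvPolynomial.monomial b 1}) ^ K) →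
    ∀ (f f₀ : MvPolynomial (Fin n) k), f₀ = MvPolynomial.weightedHomogeneousComponent w D f →
    (∀ m < D, MvPolynomial.weightedHomogeneousComponent w m f = 0) → f₀ ≠ 0 → (Ideal.span {f}).IsPrime →
    (∀ j : Fin n, Ideal.Quotient.mk (Ideal.span {f}) (MvPolynomial.X j) ≠ 0) →
    ∀ (fh : MvPolynomial (Option (Fin n)) k), fh = ∑ b ∈ f.support, MvPolynomial.monomial
      (Finsupp.mapDomain some b + Finsupp.single none (Finsupp.weight w b - D)) (MvPolynomial.coeff b f) →
    (∀ (P' : Ideal (MvPolynomial (Option (Fin n)) k ⧸ Ideal.span {fh})) [P'.IsMaximal],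
      Ideal.Quotient.mk (Ideal.span {fh}) (MvPolynomial.X (some v)) ∉ P' →
      Ideal.Quotient.mk (Ideal.span {fh}) (MvPolynomial.X none) ∈ P' →
      (∀ d : ℕ, ringKrullDim (Localization.AtPrime P') = d → ∀ t : Fin d → Localization.AtPrime P',
        (Ideal.span (Set.range t)).radical.IsMaximal →
          RingTheory.Sequence.IsWeaklyRegular (Localization.AtPrime P') (List.ofFn t) ∧
          ∀ y : Localization.AtPrime P', (∃ e : ℕ, y ^ p ^ e ∈ Ideal.span
            ((fun z : Localization.AtPrime P' => z ^ p ^ e) ''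
              (Ideal.span (Set.range t) : Set (Localization.AtPrime P')))) → y ∈ Ideal.span (Set.range t)) ∨
      (∀ (Q₀ : Ideal (MvPolynomial (Fin n) k ⧸ Ideal.span {f₀})) [Q₀.IsMaximal],
        (∀ j : Fin n, Ideal.Quotient.mk (Ideal.span {f₀}) (MvPolynomial.X j) ∈ Q₀ ↔
          Ideal.Quotient.mk (Ideal.span {fh}) (MvPolynomial.X (some j)) ∈ P') →
        ∀ d : ℕ, ringKrullDim (Localization.AtPrime Q₀) = d → ∀ t : Fin d → Localization.AtPrime Q₀,
          (Ideal.span (Set.range t)).radical.IsMaximal →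
            RingTheory.Sequence.IsWeaklyRegular (Localization.AtPrime Q₀) (List.ofFn t) ∧
            ∀ y : Localization.AtPrime Q₀, (∃ e : ℕ, y ^ p ^ e ∈ Ideal.span
              ((fun z : Localization.AtPrime Q₀ => z ^ p ^ e) ''
                (Ideal.span (Set.range t) : Set (Localization.AtPrime Q₀)))) → y ∈ Ideal.span (Set.range t))) →
    ∀ (Q : Ideal (blowupAlgebra ((Ideal.span {m : MvPolynomial (Fin n) k | ∃ b : Fin n →₀ ℕ, N ≤ Finsupp.weight w b ∧
        m = MvPolynomial.monomial b 1}).map (Ideal.Quotient.mk (Ideal.span {f}))) (Ideal.Quotient.mk (Ideal.span {f}) (MvPolynomial.X v) ^ c)))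
      [Q.IsMaximal],
      algebraMap (MvPolynomial (Fin n) k ⧸ Ideal.span {f}) (blowupAlgebra ((Ideal.span {m : MvPolynomial (Fin n) k | ∃ b : Fin n →₀ ℕ,
        N ≤ Finsupp.weight w b ∧ m = MvPolynomial.monomial b 1}).map (Ideal.Quotient.mk (Ideal.span {f})))
          (Ideal.Quotient.mk (Ideal.span {f}) (MvPolynomial.X v) ^ c)) (Ideal.Quotient.mk (Ideal.span {f}) (MvPolynomial.X v) ^ c) ∈ Q →
      ∀ d : ℕ, ringKrullDim (Localization.AtPrime Q) = d → ∀ s : Fin d → Localization.AtPrime Q,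
        (Ideal.span (Set.range s)).radical.IsMaximal →
          RingTheory.Sequence.IsWeaklyRegular (Localization.AtPrime Q) (List.ofFn s) ∧
          ∀ y : Localization.AtPrime Q, (∃ e : ℕ, y ^ p ^ e ∈ Ideal.span
            ((fun z : Localization.AtPrime Q => z ^ p ^ e) ''
              (Ideal.span (Set.range s) : Set (Localization.AtPrime Q)))) → y ∈ Ideal.span (Set.range s) := by
  intro p _ k _ _ n w v hw N c D hcN hc hpow f f₀ hf₀ hD0 hD hfprime hXne fh hfh hcone Q _ huQ
  classical
  haveI := hfprime
  haveI : IsDomain (MvPolynomial (Fin n) k ⧸ Ideal.span {f}) := Ideal.Quotient.isDomain _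
  have hN : 0 < N := hcN ▸ Nat.mul_pos hc hw
  have hf0 : MvPolynomial.weightedHomogeneousComponent w D f ≠ 0 := hf₀ ▸ hD
  haveI hfhprime : (Ideal.span {fh}).IsPrime := by
    haveI := FilteredReesDomain.isDomain_rees w D f fh hfh hD0 hf0 hfprime
    exact (Ideal.Quotient.isDomain_iff_prime _).mp inferInstance
  -- the coaction on `T′♮`
  obtain ⟨β, hβX, hβk, hβhom, -, -⟩ := WeightCoactionZ.exists_weightCoactionZ
    (fun o : Option (Fin n) => o.elim (-1 : ℤ) (fun j => (w j : ℤ))) fh (D : ℤ)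
    (FilteredReesCarrier.fh_isWeightedHomogeneous w D f fh hfh hD0) (MvPolynomial.X (some v) ^ c) (N : ℤ) (by
      have h1 := (MvPolynomial.isWeightedHomogeneous_X k (fun o : Option (Fin n) => o.elim (-1 : ℤ) (fun j => (w j : ℤ)))
        (some v)).pow c
      rwa [Option.elim_some, nsmul_eq_mul, ← Nat.cast_mul, hcN] at h1)
    (Ideal.Quotient.mk (Ideal.span {fh}) (MvPolynomial.X (some v)) ^ c) (map_pow _ _ _)
  -- the characterising identity in `aeval` form
  have hlam : ∀ a : MvPolynomial (Option (Fin n)) k,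
      β (algebraMap (MvPolynomial (Option (Fin n)) k ⧸ Ideal.span {fh}) _ (Ideal.Quotient.mk (Ideal.span {fh}) a)) =
        MvPolynomial.aeval (fun o : Option (Fin n) => single (o.elim (-1 : ℤ) (fun j => (w j : ℤ)))
          (algebraMap (MvPolynomial (Option (Fin n)) k ⧸ Ideal.span {fh})
            (Localization.Away (Ideal.Quotient.mk (Ideal.span {fh}) (MvPolynomial.X (some v)) ^ c))
            (Ideal.Quotient.mk (Ideal.span {fh}) (MvPolynomial.X o)))) a := by
    intro a
    have h : (β.comp (algebraMap (MvPolynomial (Option (Fin n)) k ⧸ Ideal.span {fh}) _)).comp (Ideal.Quotient.mk (Ideal.span {fh})) =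
        (MvPolynomial.aeval (fun o : Option (Fin n) => single (o.elim (-1 : ℤ) (fun j => (w j : ℤ)))
          (algebraMap (MvPolynomial (Option (Fin n)) k ⧸ Ideal.span {fh})
            (Localization.Away (Ideal.Quotient.mk (Ideal.span {fh}) (MvPolynomial.X (some v)) ^ c))
            (Ideal.Quotient.mk (Ideal.span {fh}) (MvPolynomial.X o))))).toRingHom := by
      refine MvPolynomial.ringHom_ext (fun r => ?_) (fun o => ?_)
      · rw [RingHom.comp_apply, RingHom.comp_apply, AlgHom.toRingHom_eq_coe, RingHom.coe_coe, MvPolynomial.aeval_C,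
          ← MvPolynomial.algebraMap_eq, Ideal.Quotient.mk_algebraMap, ← IsScalarTower.algebraMap_apply, hβk,
          LaurentPolynomial.algebraMap_apply, ← single_eq_C]
      · rw [RingHom.comp_apply, RingHom.comp_apply, AlgHom.toRingHom_eq_coe, RingHom.coe_coe, MvPolynomial.aeval_X, hβX]
    exact RingHom.congr_fun h a
  -- the degree-0 subalgebra and the filtered chart iso
  obtain ⟨T₀, hT₀⟩ := RingVeronese.exists_degSubalgebra (k := k) β (fun r => by rw [hβk, ← single_eq_C])
  have hι' := FilteredChartIso.exists_filteredChartIso w f D fh hfh hD0 hf0 hfprime hfhprime v (hXne v) N c hcN hpow β hβhom T₀ hT₀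
  obtain ⟨ι, hιu⟩ := hι'
  -- instances on the chart
  haveI : Algebra.FiniteType (MvPolynomial (Fin n) k ⧸ Ideal.span {f}) (blowupAlgebra ((Ideal.span {m : MvPolynomial (Fin n) k |
      ∃ b : Fin n →₀ ℕ, N ≤ Finsupp.weight w b ∧ m = MvPolynomial.monomial b 1}).map (Ideal.Quotient.mk (Ideal.span {f})))
      (Ideal.Quotient.mk (Ideal.span {f}) (MvPolynomial.X v) ^ c)) :=
    GradedChartDescent.finiteType_blowupAlgebra _ (IsNoetherian.noetherian _) _
  haveI : IsNoetherianRing (blowupAlgebra ((Ideal.span {m : MvPolynomial (Fin n) k |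
      ∃ b : Fin n →₀ ℕ, N ≤ Finsupp.weight w b ∧ m = MvPolynomial.monomial b 1}).map (Ideal.Quotient.mk (Ideal.span {f})))
      (Ideal.Quotient.mk (Ideal.span {f}) (MvPolynomial.X v) ^ c)) :=
    Algebra.FiniteType.isNoetherianRing (MvPolynomial (Fin n) k ⧸ Ideal.span {f}) _
  haveI : IsDomain (Localization.Away (Ideal.Quotient.mk (Ideal.span {f}) (MvPolynomial.X v) ^ c)) :=
    IsLocalization.isDomain_localization (powers_le_nonZeroDivisors_of_noZeroDivisors (pow_ne_zero c (hXne v)))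
  haveI : CharP (blowupAlgebra ((Ideal.span {m : MvPolynomial (Fin n) k |
      ∃ b : Fin n →₀ ℕ, N ≤ Finsupp.weight w b ∧ m = MvPolynomial.monomial b 1}).map (Ideal.Quotient.mk (Ideal.span {f})))
      (Ideal.Quotient.mk (Ideal.span {f}) (MvPolynomial.X v) ^ c)) p :=
    charP_of_injective_algebraMap (algebraMap k _).injective p
  -- the Rees–Veronese interface, then the chart core
  exact FilteredReesInterface.filteredReesInterface n w v hw N c D hcN hc f fh hfh hD0 β hlam T₀ hT₀ ι _ hιu _
    (fun A' _ ρ hρ hsN T _ ι' e heN => filteredChartClause_core_direct p k n w D f fh hfh hD0 f₀ hf₀ hD hfprime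
      hXne v c hc hcone A' ρ hρ N hsN _ T ι' e _ heN Q huQ)

end Summit.ResolutionOfSingularities.ResolutionOfSingularities.Theorems.FInjectiveMacaulayfication.FilteredChartClauseDirect

end
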